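import Mathlib
import Literature.NumberTheory.Transcendental.GammaFields
import Literature.NumberTheory.Transcendental.GammaIsoAlgebraicStep

/-!
# Case II core, file 1: A-extensions of a strong base and their canonical level tower
(helper file for the registered stub `stub_caseII_core` of line `eac-extends-core-automorphisms`,
crux stmt-Schanuel-0968 `Summit.Schanuel.Schanuel.Theses.RigidCore.AclSubsetLogFreeCore`)

Setting (abstract exponential field `E` of characteristic `0`, Bays–Kirby Γ-field calculus of
`Literature/NumberTheory/Transcendental/GammaFields.lean`): a strong `ℚ`-subspace `V ◁ E` and a
subspace `U ⊇ V` obtained from `V` by finitely many **A-steps** `v i` (each `v i` algebraic over the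
Γ-field `ℚ(gens W)` of the previous space `W` and outside `W`).

* `isStrong_and_predim_eq_zero_of_forall_mem_acl` — adjoining finitely many elements, each algebraic
  over the Γ-field of the space reached so far, to a strong space keeps it strong with `δ = 0`
  (Bays–Kirby Lemma 4.8, iterated).
* The **canonical level tower** of the pair `V ≤ U`: any sequence `Y : ℕ → Submodule ℚ E` with
  `Y 0 = V`, `Y (s+1) = U ⊓ span (acl (gens (Y s)))` ("all elements of `U` algebraic over the Γ-field
  of the previous level") is increasing inside `U` (`tower_mono`, `tower_le`), consists of strong
  `δ = 0` extensions of `V` (`tower_isStrong`), EXHAUSTS `U` (`tower_exhausts`), and satisfies the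
  transversality `exp u ∈ acl (gens (Y s)) → u ∈ U → u ∈ Y s` (`mem_tower_of_exp_mem_acl`): a
  logarithm never enters an A-extension except through the level where it already lives.

No automorphism appears in this file; files 2–5 add the branch shift `θ`.
-/

noncomputable section

set_option linter.dupNamespace false

open Set
open Literature.ModelTheory.ExponentialFields Literature.ModelTheory.ExponentialFields.ExponentialRing
open Literature.NumberTheory.Transcendental Literature.NumberTheory.Transcendental.GammaField

namespace Summit.Schanuel.Schanuel.Theorems.RigidCore

namespace CaseIICore

variable {E : Type*} [Field E] [CharZero E] [ExponentialRing E]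

/-! ### Iterated A-steps over a strong space -/

omit [ExponentialRing E] in
/-- The prefix spaces `Λ + ℚ(x '' Iio i)` of an enumerated adjunction increase with `i`. [folklore] -/
theorem prefix_mono (Λ : Submodule ℚ E) {n : ℕ} (x : Fin n → E) {i j : Fin n} (h : i ≤ j) :
    Λ ⊔ Submodule.span ℚ (x '' Set.Iio i) ≤ Λ ⊔ Submodule.span ℚ (x '' Set.Iio j) :=
  sup_le_sup_left (Submodule.span_mono (image_mono fun _ hk => lt_of_lt_of_le hk h)) _

omit [ExponentialRing E] in
/-- The prefix space at `i` together with `x i` is the prefix space "at `i + 1`": its span with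
`{x i}` is `Λ + ℚ(x '' Iic i)`. [folklore] -/
theorem prefix_sup_span_singleton (Λ : Submodule ℚ E) {n : ℕ} (x : Fin n → E) (i : Fin n) :
    (Λ ⊔ Submodule.span ℚ (x '' Set.Iio i)) ⊔ Submodule.span ℚ {x i} =
      Λ ⊔ Submodule.span ℚ (x '' Set.Iic i) := by
  rw [sup_assoc, ← Submodule.span_union, ← image_singleton (f := x), ← image_union,
    Set.Iio_union_right]

omit [ExponentialRing E] in
/-- Every prefix space is contained in `Λ + ℚ(range x)`. [folklore] -/
theorem prefix_le_sup_range (Λ : Submodule ℚ E) {n : ℕ} (x : Fin n → E) (i : Fin n) :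
    Λ ⊔ Submodule.span ℚ (x '' Set.Iio i) ≤ Λ ⊔ Submodule.span ℚ (range x) :=
  sup_le_sup_left (Submodule.span_mono (image_subset_range _ _)) _

/-- **Iterated Lemma 4.8 (A-steps), all prefixes.** If `Λ ◁ E` and `x₀, …, xₙ₋₁` are such that
each `xᵢ` is algebraic over the Γ-field of `Λ + ℚ(x₀, …, xᵢ₋₁)`, then every prefix space
`Λ + ℚ(x₀, …, xₖ₋₁)` (`k ≤ n`) is strong and has predimension `0` over `Λ`. (Elements already in the
previous space are allowed: they are skipped.) [cite: BaysKirby2018ANT, Lemma 4.8] -/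
theorem prefix_isStrong_and_predim_eq_zero {Λ : Submodule ℚ E} (hΛ : IsStrong Λ)
    {n : ℕ} (x : Fin n → E)
    (hx : ∀ i : Fin n, x i ∈ acl (gens (Λ ⊔ Submodule.span ℚ (x '' Set.Iio i)))) :
    ∀ k : ℕ, k ≤ n →
      IsStrong (Λ ⊔ Submodule.span ℚ (x '' {j : Fin n | (j : ℕ) < k})) ∧
        predim Λ (Λ ⊔ Submodule.span ℚ (x '' {j : Fin n | (j : ℕ) < k})) = 0 := by
  classical
  intro k hk
  induction k with
  | zero =>
    have h0 : (x '' {j : Fin n | (j : ℕ) < 0}) = ∅ := by simp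
    rw [h0, Submodule.span_empty, sup_bot_eq]
    exact ⟨hΛ, predim_eq_zero_of_le le_rfl⟩
  | succ k ih =>
    obtain ⟨hs, hδ⟩ := ih (Nat.le_of_succ_le hk)
    set W : Submodule ℚ E := Λ ⊔ Submodule.span ℚ (x '' {j : Fin n | (j : ℕ) < k}) with hW
    have hkn : k < n := hk
    set i : Fin n := ⟨k, hkn⟩ with hi
    have hIio : (x '' {j : Fin n | (j : ℕ) < k}) = x '' Set.Iio i := by
      congr 1
    have hset : (x '' {j : Fin n | (j : ℕ) < k + 1}) = insert (x i) (x '' {j : Fin n | (j : ℕ) < k}) := by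
      rw [← image_insert_eq]; congr 1; ext j
      simp only [mem_setOf_eq, mem_insert_iff, Fin.ext_iff, hi]
      omega
    have hW' : Λ ⊔ Submodule.span ℚ (x '' {j : Fin n | (j : ℕ) < k + 1}) = W ⊔ Submodule.span ℚ {x i} := by
      rw [hset, Submodule.span_insert, hW, sup_assoc, sup_comm (Submodule.span ℚ {x i})]
    rw [hW']
    have hxi : x i ∈ acl (gens W) := by rw [hW, hIio]; exact hx i
    by_cases hmem : x i ∈ W
    · rw [sup_eq_left.2 ((Submodule.span_singleton_le_iff_mem _ _).2 hmem)]
      exact ⟨hs, hδ⟩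
    · have hδi : predim W (Submodule.span ℚ {x i}) = 0 := (td_eq_one_of_mem_acl hs hxi hmem).2
      refine ⟨isStrong_sup_span_singleton_of_mem_acl hs hxi hmem, ?_⟩
      have hΛW : Λ ≤ W := le_sup_left
      have hfgΛ : IsFG Λ (W ⊔ Submodule.span ℚ {x i}) := by
        rw [hW, sup_assoc, isFG_sup_left, ← Submodule.span_union]
        exact isFG_span_of_finite Λ ((toFinite _).union (finite_singleton _))
      rw [predim_add hΛW le_sup_left hfgΛ, hδ, predim_sup_left, hδi, add_zero]

/-- **Iterated Lemma 4.8 (A-steps)**: the whole extension `Λ + ℚ(x₀, …, xₙ₋₁)` is strong with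
predimension `0` over `Λ`. [cite: BaysKirby2018ANT, Lemma 4.8] -/
theorem isStrong_and_predim_eq_zero_of_forall_mem_acl {Λ : Submodule ℚ E} (hΛ : IsStrong Λ)
    {n : ℕ} (x : Fin n → E)
    (hx : ∀ i : Fin n, x i ∈ acl (gens (Λ ⊔ Submodule.span ℚ (x '' Set.Iio i)))) :
    IsStrong (Λ ⊔ Submodule.span ℚ (range x)) ∧ predim Λ (Λ ⊔ Submodule.span ℚ (range x)) = 0 := by
  have hn := prefix_isStrong_and_predim_eq_zero hΛ x hx n le_rfl
  have hset : (x '' {j : Fin n | (j : ℕ) < n}) = range x := by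
    rw [← image_univ]; congr 1; ext j; simp
  rwa [hset] at hn

/-- **Iterated Lemma 4.8 (A-steps)**: every prefix space `Λ + ℚ(x '' Iio i)` is strong.
[cite: BaysKirby2018ANT, Lemma 4.8] -/
theorem isStrong_prefix_of_forall_mem_acl {Λ : Submodule ℚ E} (hΛ : IsStrong Λ)
    {n : ℕ} (x : Fin n → E)
    (hx : ∀ i : Fin n, x i ∈ acl (gens (Λ ⊔ Submodule.span ℚ (x '' Set.Iio i)))) (i : Fin n) :
    IsStrong (Λ ⊔ Submodule.span ℚ (x '' Set.Iio i)) :=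
  (prefix_isStrong_and_predim_eq_zero hΛ x hx i (le_of_lt i.isLt)).1

/-! ### The `ℚ`-span of a relative algebraic closure -/

omit [ExponentialRing E] in
/-- `acl S` is a `ℚ`-subspace: its `ℚ`-span is itself. [folklore] -/
theorem mem_span_acl_iff {S : Set E} {u : E} : u ∈ Submodule.span ℚ (acl S) ↔ u ∈ acl S := by
  refine ⟨fun h => ?_, fun h => Submodule.subset_span h⟩
  let M : Submodule ℚ E :=
    { carrier := acl S
      add_mem' := fun ha hb => add_mem_acl ha hb
      zero_mem' := zero_mem_acl S
      smul_mem' := fun q _ ha => smul_mem_acl q ha }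
  exact (Submodule.span_le (p := M)).2 (fun y hy => hy) h

/-! ### The canonical level tower of `V ≤ U` -/

section Tower

variable {V U : Submodule ℚ E} {Y : ℕ → Submodule ℚ E}

/-- Membership in a positive level: `u ∈ Y (s+1) ↔ u ∈ U ∧ u` algebraic over `ℚ(gens (Y s))`.
[folklore] -/
theorem mem_tower_succ_iff (hYs : ∀ s, Y (s + 1) = U ⊓ Submodule.span ℚ (acl (gens (Y s))))
    {s : ℕ} {u : E} : u ∈ Y (s + 1) ↔ u ∈ U ∧ u ∈ acl (gens (Y s)) := by
  rw [hYs s, Submodule.mem_inf, mem_span_acl_iff]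

/-- Every level lies in `U`. [folklore] -/
theorem tower_le (hVU : V ≤ U) (hY0 : Y 0 = V)
    (hYs : ∀ s, Y (s + 1) = U ⊓ Submodule.span ℚ (acl (gens (Y s)))) : ∀ s, Y s ≤ U
  | 0 => hY0 ▸ hVU
  | s + 1 => hYs s ▸ inf_le_left

/-- The tower increases. [folklore] -/
theorem le_tower_succ (hVU : V ≤ U) (hY0 : Y 0 = V)
    (hYs : ∀ s, Y (s + 1) = U ⊓ Submodule.span ℚ (acl (gens (Y s)))) (s : ℕ) : Y s ≤ Y (s + 1) :=
  fun _ hu => (mem_tower_succ_iff hYs).2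
    ⟨tower_le hVU hY0 hYs s hu, subset_acl _ (mem_gens_of_mem hu)⟩

/-- The tower is monotone. [folklore] -/
theorem tower_mono (hVU : V ≤ U) (hY0 : Y 0 = V)
    (hYs : ∀ s, Y (s + 1) = U ⊓ Submodule.span ℚ (acl (gens (Y s)))) : Monotone Y :=
  monotone_nat_of_le_succ (le_tower_succ hVU hY0 hYs)

/-- The base lies in every level. [folklore] -/
theorem base_le_tower (hVU : V ≤ U) (hY0 : Y 0 = V)
    (hYs : ∀ s, Y (s + 1) = U ⊓ Submodule.span ℚ (acl (gens (Y s)))) (s : ℕ) : V ≤ Y s :=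
  hY0 ▸ tower_mono hVU hY0 hYs (Nat.zero_le s)

/-- **The levels are strong `δ = 0` extensions of the base** (for `V ◁ E` and `U` finitely
generated over `V`): each level is generated over the previous one by finitely many elements
algebraic over its Γ-field. [cite: BaysKirby2018ANT, Lemma 4.8] -/
theorem tower_isStrong_and_predim_eq_zero (hV : IsStrong V) (hfg : IsFG V U) (hVU : V ≤ U)
    (hY0 : Y 0 = V) (hYs : ∀ s, Y (s + 1) = U ⊓ Submodule.span ℚ (acl (gens (Y s)))) :
    ∀ s, IsStrong (Y s) ∧ predim V (Y s) = 0
  | 0 => by rw [hY0]; exact ⟨hV, predim_eq_zero_of_le le_rfl⟩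
  | s + 1 => by
    classical
    obtain ⟨hs, hδ⟩ := tower_isStrong_and_predim_eq_zero hV hfg hVU hY0 hYs s
    -- finitely many generators of `Y (s+1)` over `Y s`
    have hfg' : IsFG (Y s) (Y (s + 1)) :=
      (hfg.of_le_left (base_le_tower hVU hY0 hYs s)).mono (tower_le hVU hY0 hYs (s + 1))
    obtain ⟨t, htY, hle⟩ := isFG_iff_exists_finset.1 hfg'
    set x : Fin t.card → E := fun i => ((t.equivFin.symm i : t) : E) with hxdef
    have hxmem : ∀ i, x i ∈ Y (s + 1) := fun i => htY (t.equivFin.symm i).2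
    have hrange : Y s ⊔ Submodule.span ℚ (range x) = Y (s + 1) := by
      apply le_antisymm
      · exact sup_le (le_tower_succ hVU hY0 hYs s) (Submodule.span_le.2 (range_subset_iff.2 hxmem))
      · refine hle.trans (sup_le le_sup_left ((Submodule.span_mono fun y hy => ?_).trans le_sup_right))
        exact ⟨t.equivFin ⟨y, hy⟩, by simp [hxdef]⟩
    have hx : ∀ i, x i ∈ acl (gens (Y s ⊔ Submodule.span ℚ (x '' Set.Iio i))) := fun i =>
      acl_mono (gens_mono le_sup_left) ((mem_tower_succ_iff hYs).1 (hxmem i)).2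
    obtain ⟨hs', hδ'⟩ := isStrong_and_predim_eq_zero_of_forall_mem_acl hs x hx
    rw [hrange] at hs' hδ'
    refine ⟨hs', ?_⟩
    rw [predim_add (base_le_tower hVU hY0 hYs s) (le_tower_succ hVU hY0 hYs s)
      (hfg.mono (tower_le hVU hY0 hYs (s + 1))), hδ, hδ', add_zero]

/-- The levels are strong. [cite: BaysKirby2018ANT, Lemma 4.8] -/
theorem tower_isStrong (hV : IsStrong V) (hfg : IsFG V U) (hVU : V ≤ U)
    (hY0 : Y 0 = V) (hYs : ∀ s, Y (s + 1) = U ⊓ Submodule.span ℚ (acl (gens (Y s)))) (s : ℕ) :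
    IsStrong (Y s) :=
  (tower_isStrong_and_predim_eq_zero hV hfg hVU hY0 hYs s).1

/-- **The tower stabilises** (`U` finitely generated over `V`). [folklore] -/
theorem tower_stabilizes (hfg : IsFG V U) (hVU : V ≤ U)
    (hY0 : Y 0 = V) (hYs : ∀ s, Y (s + 1) = U ⊓ Submodule.span ℚ (acl (gens (Y s)))) :
    ∃ s, Y (s + 1) = Y s := by
  by_contra h
  push Not at h
  -- then `ldim V (Y s) ≥ s` for all `s`, absurd at `s = ldim V U + 1`
  have hgrow : ∀ s, s ≤ ldim V (Y s) := by
    intro s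
    induction s with
    | zero => exact Nat.zero_le _
    | succ s ih =>
      have hfgs : IsFG V (Y (s + 1)) := hfg.mono (tower_le hVU hY0 hYs (s + 1))
      have hlt : ¬ Y (s + 1) ≤ Y s := fun hle => h s (le_antisymm hle (le_tower_succ hVU hY0 hYs s))
      have hpos : 0 < ldim (Y s) (Y (s + 1)) :=
        (ldim_pos_iff (hfgs.of_le_left (base_le_tower hVU hY0 hYs s))).2 hlt
      rw [ldim_add (base_le_tower hVU hY0 hYs s) (le_tower_succ hVU hY0 hYs s) hfgs]
      omega
  have hle : ldim V (Y (ldim V U + 1)) ≤ ldim V U := ldim_mono hfg (tower_le hVU hY0 hYs _)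
  have := hgrow (ldim V U + 1)
  omega

/-- **The tower exhausts an A-extension**: if `U = V + ℚ(v₀, …, vₛ₋₁)` with each `vᵢ` algebraic
over the Γ-field of `V + ℚ(v₀, …, vᵢ₋₁)`, then some level equals `U`. [folklore] -/
theorem tower_exhausts (hfg : IsFG V U) (hVU : V ≤ U)
    (hY0 : Y 0 = V) (hYs : ∀ s, Y (s + 1) = U ⊓ Submodule.span ℚ (acl (gens (Y s))))
    {n : ℕ} (v : Fin n → E) (hU : U = V ⊔ Submodule.span ℚ (range v))
    (hvA : ∀ i : Fin n, v i ∈ acl (gens (V ⊔ Submodule.span ℚ (v '' Set.Iio i)))) :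
    ∃ T, Y T = U := by
  obtain ⟨s, hs⟩ := tower_stabilizes hfg hVU hY0 hYs
  refine ⟨s, le_antisymm (tower_le hVU hY0 hYs s) ?_⟩
  -- every `v i` lies in `Y s`, by strong induction on `i`
  have hv : ∀ k : ℕ, ∀ i : Fin n, (i : ℕ) = k → v i ∈ Y s := by
    intro k
    induction k using Nat.strong_induction_on with
    | _ k ih =>
      intro i hik
      have hpre : V ⊔ Submodule.span ℚ (v '' Set.Iio i) ≤ Y s := by
        refine sup_le (base_le_tower hVU hY0 hYs s) (Submodule.span_le.2 ?_)
        rintro _ ⟨j, hj, rfl⟩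
        exact ih j (by rw [← hik]; exact hj) j rfl
      have hacl : v i ∈ acl (gens (Y s)) := acl_mono (gens_mono hpre) (hvA i)
      have hvU : v i ∈ U := by
        rw [hU]; exact Submodule.mem_sup_right (Submodule.subset_span ⟨i, rfl⟩)
      have hmem : v i ∈ Y (s + 1) := (mem_tower_succ_iff hYs).2 ⟨hvU, hacl⟩
      rwa [hs] at hmem
  rw [hU]
  exact sup_le (base_le_tower hVU hY0 hYs s)
    (Submodule.span_le.2 (range_subset_iff.2 fun i => hv i i rfl))

/-- **Transversality of the tower**: in an A-extension `U` of a strong `V`, an element `u ∈ U`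
whose exponential is algebraic over the Γ-field of a level already lies in that level ("a
logarithm enters an A-extension only through the level where it lives"): otherwise the last
`vᵢ` needed to write `u` over `Y s` would have both `vᵢ` and `exp vᵢ` algebraic over the strong
Γ-field of `Y s + ℚ(v₀, …, vᵢ₋₁)` while lying outside it, against
`GammaField.exp_not_mem_acl_of_mem_acl`. [cite: BaysKirby2018ANT, Lemma 4.8, §4.4] -/
theorem mem_tower_of_exp_mem_acl (hV : IsStrong V) (hfg : IsFG V U) (hVU : V ≤ U)
    (hY0 : Y 0 = V) (hYs : ∀ s, Y (s + 1) = U ⊓ Submodule.span ℚ (acl (gens (Y s))))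
    {n : ℕ} (v : Fin n → E) (hU : U = V ⊔ Submodule.span ℚ (range v))
    (hvA : ∀ i : Fin n, v i ∈ acl (gens (V ⊔ Submodule.span ℚ (v '' Set.Iio i))))
    (s : ℕ) {u : E} (huU : u ∈ U) (hexp : exp u ∈ acl (gens (Y s))) : u ∈ Y s := by
  classical
  by_contra hu
  -- the prefix spaces over the level `Y s`
  set W : ℕ → Submodule ℚ E := fun k => Y s ⊔ Submodule.span ℚ (v '' {j : Fin n | (j : ℕ) < k})
    with hWdef
  have hW0 : W 0 = Y s := by simp [hWdef]
  have hWn : u ∈ W n := by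
    have hset : (v '' {j : Fin n | (j : ℕ) < n}) = range v := by
      rw [← image_univ]; congr 1; ext j; simp
    have : U ≤ W n := by
      rw [hU, hWdef]
      simp only [hset]
      exact sup_le_sup_right (base_le_tower hVU hY0 hYs s) _
    exact this huU
  -- least `k` with `u ∈ W k`; it is positive
  have hex : ∃ k, u ∈ W k := ⟨n, hWn⟩
  have hk : u ∈ W (Nat.find hex) := Nat.find_spec hex
  have hkpos : 0 < Nat.find hex := by
    rw [Nat.pos_iff_ne_zero]
    intro h0
    rw [h0, hW0] at hk
    exact hu hk
  have hkn : Nat.find hex ≤ n := Nat.find_min' hex hWn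
  obtain ⟨m, hm⟩ : ∃ m, Nat.find hex = m + 1 := ⟨Nat.find hex - 1, by omega⟩
  rw [hm] at hk
  have hnot : u ∉ W m := Nat.find_min hex (by omega)
  have hmn : m < n := by omega
  set i : Fin n := ⟨m, hmn⟩ with hi
  -- `W (m+1) = W m + ℚ vᵢ`
  have hset : (v '' {j : Fin n | (j : ℕ) < m + 1}) = insert (v i) (v '' {j : Fin n | (j : ℕ) < m}) := by
    rw [← image_insert_eq]; congr 1; ext j
    simp only [mem_setOf_eq, mem_insert_iff, Fin.ext_iff, hi]
    omega
  have hWsucc : W (m + 1) = W m ⊔ Submodule.span ℚ {v i} := by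
    simp only [hWdef]
    rw [hset, Submodule.span_insert, sup_assoc, sup_comm (Submodule.span ℚ {v i})]
  -- `W m` is strong: the `v j` are algebraic over the Γ-fields of the prefix spaces over `Y s ⊇ V`
  have hvA' : ∀ j : Fin n, v j ∈ acl (gens (Y s ⊔ Submodule.span ℚ (v '' Set.Iio j))) := fun j =>
    acl_mono (gens_mono (sup_le_sup_right (base_le_tower hVU hY0 hYs s) _)) (hvA j)
  have hWm : IsStrong (W m) := by
    have := isStrong_prefix_of_forall_mem_acl (tower_isStrong hV hfg hVU hY0 hYs s) v hvA' i
    simp only [hWdef]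
    exact this
  -- write `u = w + q vᵢ` with `q ≠ 0`
  rw [hWsucc] at hk
  obtain ⟨w, hw, z, hz, hwz⟩ := Submodule.mem_sup.1 hk
  obtain ⟨q, rfl⟩ := Submodule.mem_span_singleton.1 hz
  have hq : q ≠ 0 := by
    rintro rfl
    rw [zero_smul, add_zero] at hwz
    exact hnot (hwz ▸ hw)
  -- `vᵢ ∉ W m`, `vᵢ` and `exp vᵢ` both algebraic over `ℚ(gens (W m))`
  have hvi_not : v i ∉ W m := fun hvi =>
    hnot (hwz ▸ (W m).add_mem hw ((W m).smul_mem q hvi))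
  have hvi_acl : v i ∈ acl (gens (W m)) := by
    have := hvA' i
    simp only [hWdef]
    exact this
  have hexpW : exp u ∈ acl (gens (W m)) :=
    acl_mono (gens_mono (show Y s ≤ W m by simp only [hWdef]; exact le_sup_left)) hexp
  have hexpqv : exp (q • v i) ∈ acl (gens (W m)) := by
    have e1 : q • v i = u + -w := by rw [← hwz]; abel
    rw [e1, exp_add, exp_neg_eq_inv]
    exact mul_mem_acl hexpW (inv_mem_acl (subset_acl _ (exp_mem_gens hw)))
  have hexpvi : exp (v i) ∈ acl (gens (W m)) := by
    have e2 : v i = q⁻¹ • (q • v i) := by rw [smul_smul, inv_mul_cancel₀ hq, one_smul]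
    rw [e2]
    exact exp_smul_mem_acl _ hexpqv
  exact exp_not_mem_acl_of_mem_acl hWm hvi_acl hvi_not (acl_mono (subset_insert _ _) hexpvi)

end Tower

end CaseIICore

/-! ### Registered helper (crux stub list of stmt-Schanuel-0968) -/

/-- **Registered form of `CaseIICore.mem_tower_of_exp_mem_acl`** (all binders explicit): an element
of `U` whose exponential is algebraic over the Γ-field of a level of the canonical tower already lies
in that level. [cite: BaysKirby2018ANT, Lemma 4.8, §4.4] -/
theorem caseII_mem_tower_of_exp_mem_acl {E : Type*} [Field E] [CharZero E] [ExponentialRing E]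
    {V U : Submodule ℚ E} {Y : ℕ → Submodule ℚ E} (hV : IsStrong V) (hfg : IsFG V U) (hVU : V ≤ U)
    (hY0 : Y 0 = V) (hYs : ∀ s, Y (s + 1) = U ⊓ Submodule.span ℚ (acl (gens (Y s))))
    {n : ℕ} (v : Fin n → E) (hU : U = V ⊔ Submodule.span ℚ (range v))
    (hvA : ∀ i : Fin n, v i ∈ acl (gens (V ⊔ Submodule.span ℚ (v '' Set.Iio i))))
    (s : ℕ) {u : E} (huU : u ∈ U) (hexp : exp u ∈ acl (gens (Y s))) : u ∈ Y s :=
  CaseIICore.mem_tower_of_exp_mem_acl hV hfg hVU hY0 hYs v hU hvA s huU hexp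

end Summit.Schanuel.Schanuel.Theorems.RigidCore
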